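/-
Copyright: the b2b-balaban cell (near-miss cell 7), T⁴-continuum fan-out; row NE7b ROUND-2 swarm, seat
t4-ne7b-formalise-leaf-04 (gen 3) — row S6g′(a), file 6 «THE REGION READING UNDER CLUSTER CONTACT» (journal CLAIM
l.9299, located interface point F-leaf04g3-1 l.9871).  Released under the licence of the surrounding project.
-/
import Summits.QuantumFields.BalabanUV.T4Continuum.Support.HistoryZoneMassPiecesLaw

/-!
# Zone mass for PIECES, III: the region reading under CLUSTER (forest) contact, and the law for its pieces

Summits-side support leaf of the T⁴-continuum cell (rung (B)+1 on a FINITE torus only; NOT infinite volume, NOT the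
mass gap, NOT the Clay statement; NOT a proof of the spine estimate NE7b).  Row NE7b, route «COUNT», row S6g′
«MASS-BASED SIBLING COUNT» (R-OWNER-22-12 (2)), step (a), for the COUNT's admissible placements (F-leaf04g3-1): leaf-07
g2's levelled region reading `HistoryZones.regZoneD sh n L K lv c reg` (the `c`-thickening of the union of the births'
regions blocked to the current level) has LINKED zones on every PIECE of `G` as soon as (i) every birth region is in
range and `ρr`-linked and (ii) at every piece that is a merger the zones of its CLUSTER PARTS
(`HistoryZoneEvolve.parts sh (st e) (merge Y Z e)` — the maximal strictly older sub-structures and the fresh births)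
are TOUCH-CONNECTED at the merger's step («zones share a cell», `HistoryZoneMassPieces.TConn`) — which is what a
canonically admissible placement supplies (`HistoryJoinsAdm.LocalTop`: a contact forest among the join's parts), and
NOT contact at every binary merge node (`BirthRegionsD.contact`, the realised placement's property,
`HistoryZoneMassRegions`).  Proof by induction on TIME alone: at a cluster's step its parts are strictly older pieces
(linked one step earlier, then blocked: `linked_coreZoneD_steps`) or fresh births (region binder), and a
touch-connected family of linked sets bridged within `2c` is linked (`linked_lunion_of_tconn`).  Then the law for
pieces (`HistoryZoneMassPiecesLaw.card_zone_le_pieces`) applies with NO linked∕birth-cardinality binder left.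
[folklore] finite geometry + bookkeeping on OUR carriers; nothing is quoted from print, nothing printed is asserted, no
`[cite:]` tag, no `Prop`-valued fact minted; constants symbolic (trigger c2∕c6), currency `zmass` of p212899.

WHAT.  §1 the slim reading of the region map WITHOUT contact: `inRange_coreZoneD'` (range binder only),
**`zoneStepsD_regZoneD`** (`HistoryZoneMassPieces.ZoneStepsD` for `regZoneD`: range, union, levelled step, renewals —
leaf-07 g2's `zoneReadingD_of_birthRegionsD` minus diameter and contact).  §2 `lunion_core_parts` (the core zone of a
structure is the union of its pieces' cores, any cut, any step).  §3 **`linked_coreZoneD_pieces`** ∕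
**`linked_regZoneD_pieces`**: under the range + linked region binders and the DISPLAYED cluster-contact binder
`hconn : ∀ t₀ Y Z e, merge Y Z e ∈ parts sh t₀ G → TConn (fun a b => (regZoneD … (st e) a ∩ regZoneD … (st e) b).Nonempty)
(parts sh (st e) (merge Y Z e))`, every piece `X` of `G` has a `max ρr (2c+2)`-linked (core) zone at every step
`t ∈ [ftime X, K]`.  §4 **`card_regZoneD_le_pieces`** (+ `_half`, `_self`): the cardinality law for the pieces of `G`
read by `regZoneD` — hypotheses `1 ≤ L`, `LevelFn K lv`, chronology, range + diameter-free region binders (`ρr`-linked,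
`#reg b ≤ Cr·(fat + 1)`), `hconn`, stride∕advance∕smallness∕decay as in p213501; conclusion
`#(regZoneD … t X) ≤ zmass sh θ (2A₁C₁) (4A) t X + 2A` for every piece `X` (`ρ = max ρr (2c+2)`, `C₁ = (2c+1)^d·Cr`).
§5 sanity.  NOT HERE: the bridge `parts sh (st e) ↔ HistoryJoins.jparts st` and `LocalTop ⇒ TConn` for the
instance's translated regions (offered to leaf-05 g2, journal l.9871).

HONEST: geometry∕bookkeeping over OUR carriers; Bałaban's regions ↦ the reading stays H3; `BirthShapeNodup` NOT yet
retired; NE7b NOT proved; spine 0∕9.  HONEST DEPENDENCY (cell): continuum YM on T⁴ ⇐ BetaPertH ∧ nine spine estimates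
(0/9 proved); BetaPertH ⇐ (D1) ∧ (D4) ∧ CAP+tail; G-an2-4 gates asym, D1 and NE2/3/4.  This file changes none of it.
-/

open Finset
open Literature.MathematicalPhysics.QuantumFieldTheory.Balaban1983to89
open T4PersistenceDictionary T4PartnerMultiplicity
open Summit.QuantumFields.BalabanUV.T4Continuum.PlacementSkeleton
open Summit.QuantumFields.BalabanUV.T4Continuum.Crowding
open Summit.QuantumFields.BalabanUV.T4Continuum.ZoneSkeleton
open Summit.QuantumFields.BalabanUV.T4Continuum.ZoneTorus
open Summit.QuantumFields.BalabanUV.T4Continuum.HistoryZones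
open Summit.QuantumFields.BalabanUV.T4Continuum.HistoryZoneMass
open Summit.QuantumFields.BalabanUV.T4Continuum.HistoryZoneEvolve
open Summit.QuantumFields.BalabanUV.T4Continuum.HistoryZoneMassLaw
open Summit.QuantumFields.BalabanUV.T4Continuum.HistoryZoneEvolveLevels
open Summit.QuantumFields.BalabanUV.T4Continuum.HistoryZoneMassLawLevels
open Summit.QuantumFields.BalabanUV.T4Continuum.HistoryZoneMassRegions
open Summit.QuantumFields.BalabanUV.T4Continuum.HistoryZoneMassPieces
open Summit.QuantumFields.BalabanUV.T4Continuum.HistoryZoneMassPiecesLaw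

namespace Summit.QuantumFields.BalabanUV.T4Continuum.HistoryZoneMassCluster

noncomputable section

variable {d : ℕ} {ε : Type*} [DecidableEq ε] {sh : ε → PEv} {n L K c : ℕ} {lv : ℕ → ℕ} {G : Gen ε}
  {reg : ε → Finset (Fin d → ℕ)}

/-! ## §1 The slim reading of the region map, without contact -/

/-- the core zone of a sub-structure is in range of its level, from the RANGE binder of the birth regions alone
(leaf-07 g2's `inRange_coreZoneD` without `BirthRegionsD`) [folklore] -/
theorem inRange_coreZoneD' (hL : 1 ≤ L) (hlv : LevelFn K lv)
    (hrange : ∀ b ∈ births G, InRange (n * L ^ (K - lv (sh b).step)) (reg b)) {X : Gen ε} (hs : Sub X G) (t : ℕ) :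
    InRange (n * L ^ (K - lv t)) (coreZoneD sh L lv reg t X) := by
  intro u hu
  obtain ⟨b, hb, hbt, hu⟩ := mem_coreZoneD.1 hu
  have hr := hrange b (births_subset_of_subE hs hb)
  have hmono : lv (sh b).step ≤ lv t := hlv.monotone hbt
  have hle : n * L ^ (K - lv (sh b).step) ≤ n * L ^ (K - lv t) * L ^ (lv t - lv (sh b).step) := by
    rw [mul_assoc, ← pow_add]
    exact Nat.mul_le_mul_left _ (Nat.pow_le_pow_right hL (by omega))
  exact inRange_blocks (Nat.one_le_pow _ _ hL) (inRange_mono hle hr) u hu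

/-- **THE REGION READING IS A SLIM LEVELLED READING** (no diameter, no contact needed): range, union at mergers, the
levelled tolerant step (chronology: every birth of a structure formed by `t` is dated `≤ t`), renewals. [folklore] -/
theorem zoneStepsD_regZoneD (hL : 1 ≤ L) (hlv : LevelFn K lv) (hchr : Chrono (PEv.step ∘ sh) G)
    (hrange : ∀ b ∈ births G, InRange (n * L ^ (K - lv (sh b).step)) (reg b)) :
    ZoneStepsD sh n L K lv c G (regZoneD sh n L K lv c reg) where
  inRange t X _ := inRange_regZoneD n L K lv c reg t X
  union X Y e hs := by rw [regZoneD_merge]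
  step X t hs hft hK := by
    have hcore : coreZoneD sh L lv reg (t + 1) X ⊆
        blocks (L ^ (lv (t + 1) - lv t)) (regZoneD sh n L K lv c reg t X) := by
      have hchrX := chrono_of_sub (PEv.step ∘ sh) hs hchr
      rw [coreZoneD_succ hlv (births_step_le hchrX hft)]
      exact image_subset_image (subset_thickT c (inRange_coreZoneD' hL hlv hrange hs t))
    exact thickT_mono _ c hcore
  renew X e h t hs := by rw [regZoneD_renew]

/-! ## §2 The core zone is the union of the pieces' cores -/

/-- **THE CORE ZONE OF A STRUCTURE IS THE UNION OF ITS PIECES' CORES** (any cut `t₀`, any step `t`). [folklore] -/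
theorem lunion_core_parts (t₀ t : ℕ) :
    ∀ X : Gen ε, lunion ((parts sh t₀ X).map (coreZoneD sh L lv reg t)) = coreZoneD sh L lv reg t X
  | Gen.born b j => by simp [parts, lunion]
  | Gen.renew Y e h => by
      show lunion ((parts sh t₀ Y).map (coreZoneD sh L lv reg t)) = coreZoneD sh L lv reg t Y
      exact lunion_core_parts t₀ t Y
  | Gen.merge Y Z e => by
      simp only [parts]
      split_ifs with hlt
      · simp [lunion]
      · rw [List.map_append, lunion_append, lunion_core_parts t₀ t Y, lunion_core_parts t₀ t Z, coreZoneD_merge]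

/-! ## §3 Linked zones of pieces under cluster contact -/

/-- **THE CORE ZONES OF PIECES ARE LINKED UNDER CLUSTER CONTACT** (radius `max ρr (2c + 2)`; induction on time: a piece
formed before `t` was linked at `t − 1` and is blocked once; a piece formed AT `t` is a fresh birth or a cluster top
whose parts — strictly older pieces or fresh births, all linked at `t` — are touch-connected by `hconn`). [folklore] -/
theorem linked_coreZoneD_pieces (hL : 1 ≤ L) (hlv : LevelFn K lv) (hchr : Chrono (PEv.step ∘ sh) G)
    (hrange : ∀ b ∈ births G, InRange (n * L ^ (K - lv (sh b).step)) (reg b))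
    {ρr : ℕ} (hregL : ∀ b ∈ births G, Linked (sideD n L K lv (sh b).step) ρr (reg b))
    (hconn : ∀ (t₀ : ℕ) (Y Z : Gen ε) (e : ε), Gen.merge Y Z e ∈ parts sh t₀ G →
      TConn (fun a b => (regZoneD sh n L K lv c reg (sh e).step a ∩ regZoneD sh n L K lv c reg (sh e).step b).Nonempty)
        (parts sh (sh e).step (Gen.merge Y Z e))) :
    ∀ (t t₀ : ℕ) (X : Gen ε), X ∈ parts sh t₀ G → ftime (PEv.step ∘ sh) X ≤ t → t ≤ K →
      Linked (sideD n L K lv t) (max ρr (2 * c + 2)) (coreZoneD sh L lv reg t X) := by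
  intro t
  induction t using Nat.strong_induction_on with
  | _ t ih =>
  have hρ₀ : 2 ≤ max ρr (2 * c + 2) := le_max_of_le_right (by omega)
  -- a piece formed BEFORE `t`: linked at `t − 1`, then one levelled step
  have older : ∀ (t₀ : ℕ) (X : Gen ε), X ∈ parts sh t₀ G → ftime (PEv.step ∘ sh) X < t → t ≤ K →
      Linked (sideD n L K lv t) (max ρr (2 * c + 2)) (coreZoneD sh L lv reg t X) := by
    intro t₀ X hX hlt htK
    have hXG : Sub X G := sub_of_mem_parts t₀ hX
    have hchrX := chrono_of_sub (PEv.step ∘ sh) hXG hchr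
    have h := ih (t - 1) (by omega) t₀ X hX (by omega) (by omega)
    have hst := linked_coreZoneD_steps (reg := reg) hL hlv (births_step_le hchrX (t := t - 1) (by omega)) hρ₀ h 1
      (by omega)
    have ht1 : t - 1 + 1 = t := by omega
    rwa [ht1] at hst
  -- a fresh birth dated `t`
  have fresh : ∀ (b : ε) (j : ℕ), Sub (Gen.born b j) G → (sh b).step = t →
      Linked (sideD n L K lv t) (max ρr (2 * c + 2)) (coreZoneD sh L lv reg t (Gen.born b j)) := by
    intro b j hbG hbt
    subst hbt
    rw [coreZoneD_born_self]
    exact (hregL b (births_subset_of_subE hbG (by simp))).mono (le_max_left _ _)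
  intro t₀ X hX hft htK
  have hXG : Sub X G := sub_of_mem_parts t₀ hX
  have hchrX := chrono_of_sub (PEv.step ∘ sh) hXG hchr
  rcases Nat.lt_or_ge (ftime (PEv.step ∘ sh) X) t with hlt | hge
  · exact older t₀ X hX hlt htK
  · have hft' : ftime (PEv.step ∘ sh) X = t := le_antisymm hft hge
    cases X with
    | born b j => exact fresh b j hXG hft'
    | renew Y e h => exact absurd rfl (parts_not_renew t₀ hX Y e h)
    | merge Y Z e =>
        have hst : (sh e).step = t := hft'
        -- every cluster part is linked at `t`
        have hmem : ∀ q ∈ parts sh t (Gen.merge Y Z e),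
            Linked (sideD n L K lv t) (max ρr (2 * c + 2)) (coreZoneD sh L lv reg t q) := by
          intro q hq
          obtain ⟨t₂, hq₂⟩ := parts_trans hX hq
          rcases parts_cases t hq with hold | ⟨b, j, rfl, hbt⟩
          · exact older t₂ q hq₂ hold htK
          · have hqG : Sub (Gen.born b j) G := sub_of_mem_parts t₂ hq₂
            have hle : (sh b).step ≤ t :=
              (ftime_le_of_sub (PEv.step ∘ sh) (sub_of_mem_parts t hq) hchrX).trans hft
            exact fresh b j hqG (le_antisymm hle hbt)
        -- the cluster parts are touch-connected; touching thickened zones put two core cells within `2c`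
        have hc0 := hconn t₀ Y Z e hX
        rw [hst] at hc0
        have hc1 : TConn (fun a b => ∃ x ∈ coreZoneD sh L lv reg t a, ∃ y ∈ coreZoneD sh L lv reg t b,
            cdist (sideD n L K lv t) x y ≤ max ρr (2 * c + 2)) (parts sh t (Gen.merge Y Z e)) := by
          refine hc0.mono fun a ha b hb hab => ?_
          obtain ⟨z, hz⟩ := hab
          rw [mem_inter] at hz
          obtain ⟨hzr, x, hx, hdx⟩ := mem_thickT.1 hz.1
          obtain ⟨-, y, hy, hdy⟩ := mem_thickT.1 hz.2
          have haG : Sub a G := Sub.trans (sub_of_mem_parts t ha) hXG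
          have hbG : Sub b G := Sub.trans (sub_of_mem_parts t hb) hXG
          have hRa := inRange_coreZoneD' hL hlv hrange haG t
          have hRb := inRange_coreZoneD' hL hlv hrange hbG t
          rw [cdist_comm] at hdx
          have htri := cdist_triangle (hRa x hx) hzr (hRb y hy)
          have h1 : cdist (n * L ^ (K - lv t)) x y ≤ 2 * c + 2 := by omega
          exact ⟨x, hx, y, hy, h1.trans (le_max_right _ _)⟩
        have hlink := linked_lunion_of_tconn hmem hc1
        rwa [lunion_core_parts] at hlink

/-- **THE REGION READING'S ZONES OF PIECES ARE LINKED UNDER CLUSTER CONTACT**, radius `max ρr (2c + 2)`. [folklore] -/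
theorem linked_regZoneD_pieces (hL : 1 ≤ L) (hlv : LevelFn K lv) (hchr : Chrono (PEv.step ∘ sh) G)
    (hrange : ∀ b ∈ births G, InRange (n * L ^ (K - lv (sh b).step)) (reg b))
    {ρr : ℕ} (hregL : ∀ b ∈ births G, Linked (sideD n L K lv (sh b).step) ρr (reg b))
    (hconn : ∀ (t₀ : ℕ) (Y Z : Gen ε) (e : ε), Gen.merge Y Z e ∈ parts sh t₀ G →
      TConn (fun a b => (regZoneD sh n L K lv c reg (sh e).step a ∩ regZoneD sh n L K lv c reg (sh e).step b).Nonempty)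
        (parts sh (sh e).step (Gen.merge Y Z e)))
    {t t₀ : ℕ} {X : Gen ε} (hX : X ∈ parts sh t₀ G) (hft : ftime (PEv.step ∘ sh) X ≤ t) (htK : t ≤ K) :
    Linked (sideD n L K lv t) (max ρr (2 * c + 2)) (regZoneD sh n L K lv c reg t X) := by
  have h := linked_thickT c (inRange_coreZoneD' hL hlv hrange (sub_of_mem_parts t₀ hX) t)
    (linked_coreZoneD_pieces hL hlv hchr hrange hregL hconn t t₀ X hX hft htK)
  rw [max_eq_left (le_max_of_le_right (by omega) : c ≤ max ρr (2 * c + 2))] at h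
  exact h

/-! ## §4 The law for the pieces of the region reading under cluster contact -/

/-- **THE CARDINALITY LAW FOR THE REGION READING UNDER CLUSTER CONTACT** (no linked∕birth-cardinality∕binary-contact
binder): for every PIECE `X` of `G` and every step `t ∈ [ftime X, K]`,
`#(regZoneD … t X) ≤ zmass sh θ (2A₁C₁) (4A) t X + 2A`, `A₁ = (2·cth c 1 s + 1)^d`, `A = A₁·5^d`, `C₁ = (2c+1)^d·Cr`,
`ρ = max ρr (2c+2)`. [folklore] -/
theorem card_regZoneD_le_pieces (hL : 1 ≤ L) (hlv : LevelFn K lv) (hchr : Chrono (PEv.step ∘ sh) G)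
    (hrange : ∀ b ∈ births G, InRange (n * L ^ (K - lv (sh b).step)) (reg b))
    {ρr : ℕ} (hregL : ∀ b ∈ births G, Linked (sideD n L K lv (sh b).step) ρr (reg b))
    {Cr : ℝ} (hCr : 0 ≤ Cr) (hregN : ∀ b ∈ births G, ((reg b).card : ℝ) ≤ Cr * (((sh b).fat : ℝ) + 1))
    (hconn : ∀ (t₀ : ℕ) (Y Z : Gen ε) (e : ε), Gen.merge Y Z e ∈ parts sh t₀ G →
      TConn (fun a b => (regZoneD sh n L K lv c reg (sh e).step a ∩ regZoneD sh n L K lv c reg (sh e).step b).Nonempty)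
        (parts sh (sh e).step (Gen.merge Y Z e)))
    {s m : ℕ} (hs : 1 ≤ s) (hm : ∀ u : ℕ, u + s ≤ K → lv u + m ≤ lv (u + s))
    (hsmall : (((2 * cth c 1 s + 1) ^ d : ℕ) : ℝ) * (5 : ℝ) ^ d * ((max ρr (2 * c + 2) : ℕ) : ℝ) ≤ (L : ℝ) ^ m / 2)
    {θ : ℝ} (hθ0 : 0 ≤ θ) (hθ1 : θ ≤ 1) (hθs : 1 / 2 ≤ θ ^ s) :
    ∀ (t tX : ℕ) (X : Gen ε), X ∈ parts sh tX G → ftime (PEv.step ∘ sh) X ≤ t → t ≤ K →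
      ((regZoneD sh n L K lv c reg t X).card : ℝ) ≤
        zmass sh θ (2 * (((2 * cth c 1 s + 1) ^ d : ℕ) : ℝ) * ((((2 * c + 1) ^ d : ℕ) : ℝ) * Cr))
            (4 * ((((2 * cth c 1 s + 1) ^ d : ℕ) : ℝ) * (5 : ℝ) ^ d)) t X +
          2 * ((((2 * cth c 1 s + 1) ^ d : ℕ) : ℝ) * (5 : ℝ) ^ d) :=
  card_zone_le_pieces hL hlv (zoneStepsD_regZoneD hL hlv hchr hrange) hchr (ρ := max ρr (2 * c + 2))
    (le_max_of_le_right (by omega))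
    (fun _ _ _ hX hft htK => linked_regZoneD_pieces hL hlv hchr hrange hregL hconn hX hft htK)
    (C₁ := (((2 * c + 1) ^ d : ℕ) : ℝ) * Cr) (by positivity)
    (fun b j hX => by
      have hb : b ∈ births G := births_subset_of_subE hX (by simp)
      have h1 : (regZoneD sh n L K lv c reg (sh b).step (Gen.born b j)).card ≤ (2 * c + 1) ^ d * (reg b).card := by
        rw [regZoneD_born_self]
        exact card_thickT_le c (hrange b hb)
      have h2 := hregN b hb
      calc ((regZoneD sh n L K lv c reg (sh b).step (Gen.born b j)).card : ℝ)
          ≤ (((2 * c + 1) ^ d : ℕ) : ℝ) * ((reg b).card : ℝ) := by exact_mod_cast h1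
        _ ≤ (((2 * c + 1) ^ d : ℕ) : ℝ) * (Cr * (((sh b).fat : ℝ) + 1)) :=
            mul_le_mul_of_nonneg_left h2 (Nat.cast_nonneg _)
        _ = (((2 * c + 1) ^ d : ℕ) : ℝ) * Cr * (((sh b).fat : ℝ) + 1) := by ring)
    hs hm hsmall hθ0 hθ1 hθs

/-- **THE SAME WITH THE HALF-STRIDE ADVANCE** (`m := s∕2`). [folklore] -/
theorem card_regZoneD_le_pieces_half (hL : 1 ≤ L) (hlv : LevelFn K lv) (hchr : Chrono (PEv.step ∘ sh) G)
    (hrange : ∀ b ∈ births G, InRange (n * L ^ (K - lv (sh b).step)) (reg b))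
    {ρr : ℕ} (hregL : ∀ b ∈ births G, Linked (sideD n L K lv (sh b).step) ρr (reg b))
    {Cr : ℝ} (hCr : 0 ≤ Cr) (hregN : ∀ b ∈ births G, ((reg b).card : ℝ) ≤ Cr * (((sh b).fat : ℝ) + 1))
    (hconn : ∀ (t₀ : ℕ) (Y Z : Gen ε) (e : ε), Gen.merge Y Z e ∈ parts sh t₀ G →
      TConn (fun a b => (regZoneD sh n L K lv c reg (sh e).step a ∩ regZoneD sh n L K lv c reg (sh e).step b).Nonempty)
        (parts sh (sh e).step (Gen.merge Y Z e)))
    {s : ℕ} (hs : 1 ≤ s)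
    (hsmall : (((2 * cth c 1 s + 1) ^ d : ℕ) : ℝ) * (5 : ℝ) ^ d * ((max ρr (2 * c + 2) : ℕ) : ℝ) ≤
      (L : ℝ) ^ (s / 2) / 2)
    {θ : ℝ} (hθ0 : 0 ≤ θ) (hθ1 : θ ≤ 1) (hθs : 1 / 2 ≤ θ ^ s) :
    ∀ (t tX : ℕ) (X : Gen ε), X ∈ parts sh tX G → ftime (PEv.step ∘ sh) X ≤ t → t ≤ K →
      ((regZoneD sh n L K lv c reg t X).card : ℝ) ≤
        zmass sh θ (2 * (((2 * cth c 1 s + 1) ^ d : ℕ) : ℝ) * ((((2 * c + 1) ^ d : ℕ) : ℝ) * Cr))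
            (4 * ((((2 * cth c 1 s + 1) ^ d : ℕ) : ℝ) * (5 : ℝ) ^ d)) t X +
          2 * ((((2 * cth c 1 s + 1) ^ d : ℕ) : ℝ) * (5 : ℝ) ^ d) :=
  card_regZoneD_le_pieces hL hlv hchr hrange hregL hCr hregN hconn hs (fun u _ => levelFn_add_half_le hlv u s) hsmall
    hθ0 hθ1 hθs

/-- **THE LAW FOR THE WHOLE STRUCTURE** (a birth or a merger) read by the region map under cluster contact. [folklore] -/
theorem card_regZoneD_le_self (hL : 1 ≤ L) (hlv : LevelFn K lv) (hchr : Chrono (PEv.step ∘ sh) G)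
    (hrange : ∀ b ∈ births G, InRange (n * L ^ (K - lv (sh b).step)) (reg b))
    {ρr : ℕ} (hregL : ∀ b ∈ births G, Linked (sideD n L K lv (sh b).step) ρr (reg b))
    {Cr : ℝ} (hCr : 0 ≤ Cr) (hregN : ∀ b ∈ births G, ((reg b).card : ℝ) ≤ Cr * (((sh b).fat : ℝ) + 1))
    (hconn : ∀ (t₀ : ℕ) (Y Z : Gen ε) (e : ε), Gen.merge Y Z e ∈ parts sh t₀ G →
      TConn (fun a b => (regZoneD sh n L K lv c reg (sh e).step a ∩ regZoneD sh n L K lv c reg (sh e).step b).Nonempty)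
        (parts sh (sh e).step (Gen.merge Y Z e)))
    {s m : ℕ} (hs : 1 ≤ s) (hm : ∀ u : ℕ, u + s ≤ K → lv u + m ≤ lv (u + s))
    (hsmall : (((2 * cth c 1 s + 1) ^ d : ℕ) : ℝ) * (5 : ℝ) ^ d * ((max ρr (2 * c + 2) : ℕ) : ℝ) ≤ (L : ℝ) ^ m / 2)
    {θ : ℝ} (hθ0 : 0 ≤ θ) (hθ1 : θ ≤ 1) (hθs : 1 / 2 ≤ θ ^ s)
    (hG : ∀ (Y : Gen ε) (e : ε) (h : ℕ), G ≠ Gen.renew Y e h) :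
    ∀ t : ℕ, ftime (PEv.step ∘ sh) G ≤ t → t ≤ K →
      ((regZoneD sh n L K lv c reg t G).card : ℝ) ≤
        zmass sh θ (2 * (((2 * cth c 1 s + 1) ^ d : ℕ) : ℝ) * ((((2 * c + 1) ^ d : ℕ) : ℝ) * Cr))
            (4 * ((((2 * cth c 1 s + 1) ^ d : ℕ) : ℝ) * (5 : ℝ) ^ d)) t G +
          2 * ((((2 * cth c 1 s + 1) ^ d : ℕ) : ℝ) * (5 : ℝ) ^ d) := by
  intro t hft htK
  have hself : G ∈ parts sh (ftime (PEv.step ∘ sh) G + 1) G := by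
    cases G with
    | born b j => exact self_mem_parts_born b j _
    | renew Y e h => exact absurd rfl (hG Y e h)
    | merge A B e => exact self_mem_parts_merge A B (Nat.lt_succ_self _)
  exact card_regZoneD_le_pieces hL hlv hchr hrange hregL hCr hregN hconn hs hm hsmall hθ0 hθ1 hθs t _ G hself hft htK

/-! ## §5 Sanity (decided) -/

namespace Sanity

/-- cluster parts as pieces: a left-nested same-step chain `((A B) C)` at step `5` of three births (steps `0, 1, 2`)
has the THREE births as its cut-`5` pieces (the inner node `(A B)` is not a piece), while for the cut `6` the whole
chain is one piece (decided; shapes read by `Prod.fst`) -/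
example :
    (parts (Prod.fst : PEv × ℕ → PEv) 5
        (Gen.merge (Gen.merge (Gen.born (((0, 0, 0) : PEv), 0) 0) (Gen.born (((1, 0, 0) : PEv), 1) 1)
          (((5, 2, 0) : PEv), 3)) (Gen.born (((2, 0, 0) : PEv), 2) 2) (((5, 2, 0) : PEv), 4))).length = 3 ∧
    (parts (Prod.fst : PEv × ℕ → PEv) 6
        (Gen.merge (Gen.merge (Gen.born (((0, 0, 0) : PEv), 0) 0) (Gen.born (((1, 0, 0) : PEv), 1) 1)
          (((5, 2, 0) : PEv), 3)) (Gen.born (((2, 0, 0) : PEv), 2) 2) (((5, 2, 0) : PEv), 4))).length = 1 := by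
  decide

end Sanity

end

end Summit.QuantumFields.BalabanUV.T4Continuum.HistoryZoneMassCluster
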